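import Summits.KontsevichZagierPeriods.KontsevichZagierPeriods.Theses.HurwitzMicroSectors
import Literature.NumberTheory.Transcendental.BoxCoordinatePowerMap

/-!
# `DilationMove` (stmt-KontsevichZagierPeriods-3872, route HurwitzMicroSectors) — line
`coordpow-api-assembly`, stub `stub_isSemialgebraicMapOn_coordPow`

The tameness obligation of the dilation move: the coordinatewise power map
`Φₘ x = (xᵢᵐ)ᵢ` (`BoxIntegral.coordPow m`) is a `ℚ`-semialgebraic MAP on every `ℚ`-semialgebraic
set `σ ⊆ ℝⁿ`. It is the polynomial map with coordinates the monomials `Xᵢ ^ m ∈ ℚ[X₀,…,X_{n-1}]`,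
so this is `isSemialgebraicMapOn_aeval` (polynomial maps with coefficients in `k` are
`k`-semialgebraic on `k`-semialgebraic sets, [BCR 1998, §2.2]) transported along the pointwise
identity `aeval x (Xᵢ ^ m) = xᵢ ^ m` (`IsSemialgebraicMapOn.congr`).

## References

* J. Bochnak, M. Coste, M.-F. Roy, *Real Algebraic Geometry* (1998), §2.2.
* M. Kontsevich, D. Zagier, *Periods* (2001), §1.2, rule (2).
-/

noncomputable section

open Set MeasureTheory
open Literature.NumberTheory.Transcendental
open Literature.ModelTheory.ExponentialFields (IsSemialgebraic)

namespace Summit.KontsevichZagierPeriods.HurwitzMicroSectors.DilationMove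

/-- The coordinatewise power map agrees everywhere with the evaluation of the monomial family
`(Xᵢ ^ m)ᵢ`: `(aeval x (Xⱼ ^ m))ⱼ = Φₘ x`. [folklore] -/
theorem aeval_X_pow_eq_coordPow (n m : ℕ) (x : Fin n → ℝ) :
    (fun j : Fin n => MvPolynomial.aeval x ((MvPolynomial.X j : MvPolynomial (Fin n) ℚ) ^ m)) =
      BoxIntegral.coordPow m x := by
  funext j
  simp [BoxIntegral.coordPow]

/-- **Tameness of the dilation** (registered stub `stub_isSemialgebraicMapOn_coordPow` of crux
stmt-KontsevichZagierPeriods-3872). The coordinatewise power map `x ↦ (xᵢᵐ)ᵢ`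
(`BoxIntegral.coordPow m`) is a `ℚ`-semialgebraic map on every `ℚ`-semialgebraic set `σ ⊆ ℝⁿ`:
it is the polynomial map `(Xᵢ ^ m)ᵢ` with rational (indeed integer) coefficients, and polynomial
maps over `k` are `k`-semialgebraic on `k`-semialgebraic sets. [BCR 1998, §2.2] -/
theorem stub_isSemialgebraicMapOn_coordPow :
    ∀ (n m : ℕ) (σ : Set (Fin n → ℝ)), IsSemialgebraic ℚ σ →
      IsSemialgebraicMapOn ℚ σ (fun x : Fin n → ℝ => BoxIntegral.coordPow m x) := by
  intro n m σ hσ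
  refine (isSemialgebraicMapOn_aeval hσ
    (fun j => (MvPolynomial.X j : MvPolynomial (Fin n) ℚ) ^ m)).congr ?_
  intro x _
  exact aeval_X_pow_eq_coordPow n m x

end Summit.KontsevichZagierPeriods.HurwitzMicroSectors.DilationMove

end
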